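import Literature.Probability.LatticeModels.KCConfigSeedChain
import HarnessLib

/-!
# Existence of the sign-condition configuration

Topic `Literature/Probability/LatticeModels`. Assembly of a `KCSignConfig Ω G Bad` near a boundary
point `ζ` of an open path-connected set `Ω` which has exterior points near `ζ` (e.g. a Jordan
domain), from the hub (`KCConfigHub.lean`) and the seed/chain (`KCConfigSeedChain.lean`):

* `exists_hubData`: a hub point `m` on the sphere of the big ball about an exterior centre `e`,
  reached from a far point `wW ∈ Ω` by a path staying outside the closed big ball (first entry);
* `exists_config`: the configuration, with the location of its compact sets `Kmid μ`, `Kflat`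
  inside `Ω ∩ ball ζ ρ`.

All `[folklore]`; no named fact.
-/

noncomputable section

open Set Metric

namespace Literature.Probability.LatticeModels

open Site

/-! ### The hub data from a boundary point with a nearby exterior point -/

/-- **Existence of hub data with a path from a far point.** [folklore] -/
theorem exists_hubData {Ω : Set ℂ} (hΩ : IsOpen Ω) (hΩc : IsPathConnected Ω) {ζ : ℂ} (hζ : ζ ∈ frontier Ω) {ρ : ℝ}
    {e : ℂ} (he : dist e ζ < ρ / 10) (heΩ : e ∉ closure Ω) {wW : ℂ} (hwW : wW ∈ Ω) (hfar : ρ ≤ dist wW ζ) :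
    ∃ hub : HubData Ω, hub.e = e ∧ hub.ρB ≤ 51 / 500 * ρ ∧
      ∃ γW : Path wW hub.m, ∀ s, γW s ∈ Ω ∧ (hub.ρB < dist (γW s) e ∨ γW s = hub.m) := by
  -- the exterior ball
  have hζc : ζ ∈ closure Ω := frontier_subset_closure hζ
  set rstar : ℝ := infDist e Ω with hrstar
  have hrpos : 0 < rstar := by
    rw [hrstar, ← infDist_closure]; exact (isClosed_closure.notMem_iff_infDist_pos ⟨ζ, hζc⟩).1 heΩ
  have hrle : rstar ≤ dist e ζ := by rw [hrstar, ← infDist_closure]; exact infDist_le_dist_of_mem hζc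
  have hdisj : ∀ x ∈ ball e rstar, x ∉ Ω := fun x hx => ball_infDist_subset_compl hx
  set ρB : ℝ := 51 / 50 * rstar with hρB
  -- a point of `Ω` inside the big ball and a path to it
  obtain ⟨m₀, hm₀, hm₀d⟩ : ∃ m₀ ∈ Ω, dist e m₀ < ρB := by
    obtain ⟨y, hy, hyd⟩ := (infDist_lt_iff ⟨ζ, hζc⟩).1 (show infDist e (closure Ω) < ρB by rw [infDist_closure, ← hrstar, hρB]; linarith)
    obtain ⟨m₀, hm₀, hm₀y⟩ := Metric.mem_closure_iff.1 hy (ρB - dist e y) (by linarith)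
    exact ⟨m₀, hm₀, by linarith [dist_triangle e y m₀]⟩
  have hJ : JoinedIn Ω wW m₀ := hΩc.joinedIn wW hwW m₀ hm₀
  set γ : Path wW m₀ := hJ.somePath with hγ
  have hγΩ : ∀ t, γ t ∈ Ω := hJ.somePath_mem
  -- the first entry into the closed big ball
  have hout : ρB < dist wW e := by
    have := dist_triangle wW e ζ
    have hρ10 : dist e ζ < ρ / 10 := he
    have h2 : ρB < ρ - ρ / 10 := by
      rw [hρB]
      have : rstar < ρ / 10 := lt_of_le_of_lt hrle hρ10
      linarith
    linarith
  obtain ⟨hdist, hbefore⟩ := dist_firstEntry_eq γ hout (by rw [dist_comm]; exact hm₀d.le)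
  set t₀ := firstEntry γ (closedBall e ρB) with ht₀
  set m : ℂ := γ t₀ with hm
  have hmΩ : m ∈ Ω := hγΩ t₀
  -- the closest lattice direction and the hub scale
  obtain ⟨km, hkm⟩ := exists_closest_dir (e - m)
  have hne : (Ωᶜ).Nonempty := ⟨e, fun h => heΩ (subset_closure h)⟩
  obtain ⟨-, -, -, -, hdm, hball⟩ := exists_nearest_compl hΩ hne hmΩ
  set rh : ℝ := infDist m Ωᶜ / 11 with hrh
  have hcb : closedBall m (10 * rh) ⊆ Ω := fun x hx => hball (by rw [mem_ball]; rw [mem_closedBall] at hx; rw [hrh] at hx; linarith)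
  let hub : HubData Ω :=
    { m := m, e := e, rstar := rstar, km := km, rh := rh
      isOpen := hΩ
      rstar_pos := hrpos
      ball_disjoint := hdisj
      norm_sub := by rw [← dist_eq_norm, hdist]
      dir_le := hkm
      rh_pos := by rw [hrh]; positivity
      closedBall_subset := hcb }
  refine ⟨hub, rfl, ?_, ?_⟩
  · show 51 / 50 * rstar ≤ 51 / 500 * ρ
    linarith
  -- the truncated path
  · have h0 : γ.extend (min 0 (t₀ : ℝ)) = wW := by rw [min_eq_left t₀.2.1, γ.extend_zero]
    have h1 : γ.extend t₀ = m := γ.extend_extends' t₀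
    refine ⟨(γ.truncate 0 t₀).cast h0.symm h1.symm, fun s => ?_⟩
    rw [Path.cast_coe]
    show γ.extend (min (max (s : ℝ) 0) t₀) ∈ Ω ∧ (hub.ρB < dist (γ.extend (min (max (s : ℝ) 0) t₀)) e ∨ γ.extend (min (max (s : ℝ) 0) t₀) = hub.m)
    set s' : ℝ := min (max (s : ℝ) 0) t₀ with hs'
    have hs'0 : 0 ≤ s' := le_min (le_max_right _ _) t₀.2.1
    have hs'1 : s' ≤ t₀ := min_le_right _ _
    have hs'I : s' ∈ Icc (0 : ℝ) 1 := ⟨hs'0, hs'1.trans t₀.2.2⟩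
    have hext : γ.extend s' = γ ⟨s', hs'I⟩ := γ.extend_extends' ⟨s', hs'I⟩
    rw [hext]
    refine ⟨hγΩ _, ?_⟩
    rcases hs'1.lt_or_eq with h | h
    · left
      exact hbefore ⟨s', hs'I⟩ (Subtype.coe_lt_coe.1 h)
    · right
      show γ ⟨s', hs'I⟩ = γ t₀
      congr 1; exact Subtype.ext h

/-! ### Auxiliary facts for the assembly -/

/-- The `ℓ¹` norm of a frame combination. [folklore] -/
theorem l1norm_frame_comb (k : Fin 4) (x y : ℝ) : l1norm ((x : ℂ) * dirVec k + (y : ℂ) * dirVec (k + 1)) = |x| + |y| := by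
  obtain ⟨h0, h1⟩ := cornerUnit_succ_apply k
  simp only [l1norm, Complex.add_re, Complex.add_im, Complex.mul_re, Complex.mul_im, Complex.ofReal_re, Complex.ofReal_im, dirVec_re, dirVec_im,
    h0, h1, zero_mul, sub_zero, add_zero, Int.cast_neg]
  rcases cornerUnit_apply_cases k with ⟨e0, e1⟩ | ⟨e0, e1⟩ | ⟨e0, e1⟩ | ⟨e0, e1⟩ <;> simp [e0, e1, abs_neg] <;> ring

namespace HubData

variable {Ω : Set ℂ} (hub : HubData Ω)

/-- The sign of end `e`: `-1` for end `0` (the `q₁` side), `+1` for end `1`. [folklore] -/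
def sg (e : Fin 2) : ℝ := if e = 0 then -1 else 1

/-- `sg e = ±1`. [folklore] -/
theorem sg_cases (e : Fin 2) : sg e = 1 ∨ sg e = -1 := by
  unfold sg; split_ifs <;> simp

/-- **The end diamonds.** At depth `t ∈ (0, r_h]` each end has an `ℓ¹`-nearest point of `Ωᶜ` at
`ℓ¹`-distance at most `23 t / 17`. [folklore] -/
theorem exists_end {t : ℝ} (ht0 : 0 < t) (ht : t ≤ hub.rh) (e : Fin 2) :
    ∃ p, p ∉ Ω ∧ 0 < l1norm (p - hub.z0 (sg e) t) ∧ {w | l1norm (w - hub.z0 (sg e) t) < l1norm (p - hub.z0 (sg e) t)} ⊆ Ω ∧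
      (∀ p', p' ∉ Ω → l1norm (p - hub.z0 (sg e) t) ≤ l1norm (p' - hub.z0 (sg e) t)) ∧ l1norm (p - hub.z0 (sg e) t) ≤ 23 * t / 17 := by
  obtain ⟨hL, hout, hbelow, -⟩ := hub.ray_spec_dEnd (sg_cases e)
  have hz : hub.z0 (sg e) t ∈ Ω := hbelow _ (by linarith) (by linarith)
  obtain ⟨p, hp, hpos, hsub, hmin⟩ := exists_l1nearest_compl hub.isOpen ⟨_, hout⟩ hz
  refine ⟨p, hp, hpos, hsub, hmin, (hmin _ hout).trans ?_⟩
  have : hub.m + ((hub.L (hub.dEnd (sg e)) : ℝ) : ℂ) * hub.dEnd (sg e) - hub.z0 (sg e) t =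
      ((t * (15 / 17) : ℝ) : ℂ) * dirVec hub.km + ((t * (sg e * (8 / 17)) : ℝ) : ℂ) * dirVec (hub.km + 1) := by
    simp only [z0, dEnd, ν, τ]; push_cast; ring
  rw [this, l1norm_frame_comb, abs_mul, abs_mul, abs_of_pos ht0]
  have h1 : |sg e * (8 / 17 : ℝ)| = 8 / 17 := by rcases sg_cases e with h | h <;> rw [h] <;> norm_num
  rw [h1, abs_of_pos (by norm_num : (0 : ℝ) < 15 / 17)]
  linarith

/-- The hub ball lies in `ball e (2 ρ_B)`. [folklore] -/
theorem closedBall_subset_ball2 : closedBall hub.m (10 * hub.rh) ⊆ ball hub.e (2 * hub.ρB) := by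
  intro x hx
  obtain ⟨hρ, hme⟩ := hub.ρB_spec
  have h := hub.rh_le
  have hr := hub.rstar_pos
  rw [mem_closedBall] at hx
  rw [mem_ball]
  have : dist hub.m hub.e = hub.ρB := by rw [dist_eq_norm, norm_sub_rev]; exact hme
  linarith [dist_triangle x hub.m hub.e]

/-- The seed point is within `2 ρ_B` of `e`. [folklore] -/
theorem dist_zStar_le {κ : ℝ} (S : hub.SeedScale κ) : dist S.zStar hub.e ≤ 2 * hub.ρB := by
  obtain ⟨hρ, hme⟩ := hub.ρB_spec
  obtain ⟨-, hle, -, -⟩ := S.sStar_spec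
  obtain ⟨-, hLle, -, -, -, -⟩ := hub.ray_spec hub.norm_ν_τ.1 (by rw [hub.rdot_ν_τ.1]; linarith [hub.ab_spec.2.2] : 7 * hub.a / 17 ≤ rdot (hub.e - hub.m) hub.ν)
  rw [hub.rdot_ν_τ.1] at hLle
  have ha : hub.a ≤ hub.ρB := by
    have := (KCSignConfig.abs_dirCoord_le_norm hub.km (hub.e - hub.m)).1
    rw [hme] at this
    exact (le_abs_self _).trans this
  have h1 : dist S.zStar hub.m ≤ hub.ρB := by
    rw [SeedScale.zStar, ax, dist_eq_norm, add_sub_cancel_left, norm_mul, Complex.norm_real, Real.norm_eq_abs, hub.norm_ν_τ.1, mul_one,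
      abs_of_pos (by linarith [hub.rh_pos, S.sStar_spec.1])]
    have : hub.L hub.ν ≤ hub.a := hLle
    linarith
  have h2 : dist hub.m hub.e = hub.ρB := by rw [dist_eq_norm, norm_sub_rev]; exact hme
  linarith [dist_triangle S.zStar hub.m hub.e]

/-- The chain windows are within `3 ρ_B` of `e`. [folklore] -/
theorem window_subset_ball3 {κ : ℝ} (S : hub.SeedScale κ) {j : ℕ} (hj : j ≤ S.Jc) : supBox (S.wc j) (50 * κ) ⊆ ball hub.e (3 * hub.ρB) := by
  intro y hy
  obtain ⟨hρ, hme⟩ := hub.ρB_spec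
  obtain ⟨hκ, hκr, -, -⟩ := S.bounds
  obtain ⟨b1, b2, -⟩ := S.chainN_bounds j
  obtain ⟨-, b4⟩ := S.chainT_bounds j
  have hT := b4 hj
  have hnorm : ‖y - S.wc j‖ < 71 * κ := norm_lt_of_sup_le hκ hy.1 hy.2
  have hN : S.NStar ≤ hub.ρB := by
    have := hub.dist_zStar_le S
    have h1 : dist S.zStar hub.m ≤ dist S.zStar hub.e + dist hub.e hub.m := dist_triangle _ _ _
    rw [SeedScale.NStar]
    have h2 : dist S.zStar hub.m = S.sStar := by
      rw [SeedScale.zStar, ax, dist_eq_norm, add_sub_cancel_left, norm_mul, Complex.norm_real, Real.norm_eq_abs, hub.norm_ν_τ.1, mul_one,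
        abs_of_pos (by linarith [hub.rh_pos, S.sStar_spec.1])]
    have h3 : dist hub.e hub.m = hub.ρB := by rw [dist_eq_norm]; exact hme
    -- crude: `s* ≤ L ν ≤ a ≤ ρ_B`
    obtain ⟨-, hle, -, -⟩ := S.sStar_spec
    obtain ⟨-, hLle, -, -, -, -⟩ := hub.ray_spec hub.norm_ν_τ.1 (by rw [hub.rdot_ν_τ.1]; linarith [hub.ab_spec.2.2] : 7 * hub.a / 17 ≤ rdot (hub.e - hub.m) hub.ν)
    rw [hub.rdot_ν_τ.1] at hLle
    have ha : hub.a ≤ hub.ρB := by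
      have := (KCSignConfig.abs_dirCoord_le_norm hub.km (hub.e - hub.m)).1
      rw [hme] at this
      exact (le_abs_self _).trans this
    have : hub.L hub.ν ≤ hub.a := hLle
    linarith [hub.rh_pos]
  have hw : ‖S.wc j - hub.m‖ ≤ hub.rh + S.NStar + 204 * κ := by
    have : S.wc j - hub.m = ((hub.rh + S.chainN j : ℝ) : ℂ) * hub.ν + ((S.chainT j : ℝ) : ℂ) * hub.τ := by
      rw [SeedScale.wc, pmid]; push_cast; ring
    rw [this]
    refine (norm_le_abs_dirCoord_add hub.km _).trans ?_
    obtain ⟨e1, e2⟩ := dirCoord_frame_comb hub.km (hub.rh + S.chainN j) (S.chainT j)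
    rw [show hub.ν = dirVec hub.km from rfl, show hub.τ = dirVec (hub.km + 1) from rfl, e1, e2,
      abs_of_pos (by linarith [hub.rh_pos])]
    linarith
  have h2 : dist hub.m hub.e = hub.ρB := by rw [dist_eq_norm, norm_sub_rev]; exact hme
  rw [mem_ball]
  have hrh := hub.scales.1
  calc dist y hub.e ≤ dist y (S.wc j) + dist (S.wc j) hub.m + dist hub.m hub.e := dist_triangle4 _ _ _ _
    _ < 71 * κ + (hub.rh + S.NStar + 204 * κ) + hub.ρB := by rw [dist_eq_norm, dist_eq_norm, h2]; linarith
    _ ≤ 3 * hub.ρB := by linarith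

/-- Points of the segment `[yMinus, m]` are axis points `ax s`, `0 ≤ s ≤ r_h - ℓ`. [folklore] -/
theorem exists_of_mem_segment_yMinus_m {x : ℂ} (hx : x ∈ segment ℝ (hub.pmid - ((hub.ell : ℝ) : ℂ) * hub.ν) hub.m) :
    ∃ s, 0 ≤ s ∧ s ≤ hub.rh - hub.ell ∧ x = hub.ax s := by
  rw [hub.ax_eq.2.2.1, hub.ax_eq.2.2.2, segment_symm] at hx
  obtain ⟨-, hℓ, hℓr, hrh⟩ := hub.scales
  exact hub.segment_ray_subset hub.ν (by linarith) hx

/-! ### The core assembly -/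

/-- **The configuration from hub data.** Given hub data, a far exceptional region `W` (open,
path-connected, bounded, relatively compact in `Ω`, outside the closed big ball) reached from the
hub point by a path off the closed big ball, and `G ⊇ ball e (3 ρ_B)`, there is a sign-condition
configuration whose sets `Kmid μ` (`μ > 0`) and `Kflat` lie in `Ω ∩ ball e (2 ρ_B)`. [folklore] -/
theorem exists_config_core {G Bad W : Set ℂ} (hG : ball hub.e (3 * hub.ρB) ⊆ G)
    (hWo : IsOpen W) (hWc : IsPathConnected W) (hWb : Bornology.IsBounded W) (hBad : Bad ⊆ W) (hWΩ : closure W ⊆ Ω)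
    (hWout : ∀ x ∈ closure W, hub.ρB < dist x hub.e) {wW : ℂ} (hwW : wW ∈ W)
    (γW : Path wW hub.m) (hγW : ∀ s, γW s ∈ Ω ∧ (hub.ρB < dist (γW s) hub.e ∨ γW s = hub.m)) :
    ∃ cfg : KCSignConfig Ω G Bad, cfg.W = W ∧ (∀ μ, 0 < μ → cfg.Kmid μ ⊆ Ω ∩ ball hub.e (2 * hub.ρB)) ∧ cfg.Kflat ⊆ Ω ∩ ball hub.e (2 * hub.ρB) := by
  obtain ⟨hρ, hme⟩ := hub.ρB_spec
  obtain ⟨hrρ, hℓ, hℓr, hrh⟩ := hub.scales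
  -- the seed scale
  have hsc : (712 : ℝ) ≤ seedClear := seedClear_ge
  set κ : ℝ := min (hub.ell / 400) (hub.rh / (4 * seedClear)) with hκdef
  have hκpos : 0 < κ := lt_min (by positivity) (by positivity)
  have S : hub.SeedScale κ :=
    { pos := hκpos
      le_ell := by have := min_le_left (hub.ell / 400) (hub.rh / (4 * seedClear)); linarith
      clear_le := by
        have h1 := min_le_right (hub.ell / 400) (hub.rh / (4 * seedClear))
        calc seedClear * κ ≤ seedClear * (hub.rh / (4 * seedClear)) := mul_le_mul_of_nonneg_left h1 (by linarith)
          _ = hub.rh / 4 := by field_simp }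
  obtain ⟨-, hκr, hκℓ, hκcl⟩ := S.bounds
  -- the end depth and the slack
  set t : ℝ := hub.rh / 40 with htdef
  have ht0 : 0 < t := by positivity
  have ht : t ≤ hub.rh := by rw [htdef]; linarith
  -- the ends
  have hend := fun e => hub.exists_end ht0 ht e
  choose p hpΩ hppos hpsub hpmin hple using hend
  set z₀ : Fin 2 → ℂ := fun e => hub.z0 (sg e) t with hz₀
  set mInf : Fin 2 → ℝ := fun e => l1norm (p e - hub.z0 (sg e) t) with hmInf
  have hzone : ∀ e w, l1norm (w - z₀ e) ≤ mInf e + 2 * t → l1norm (w - hub.z0 (sg e) t) ≤ hub.rh / 10 := by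
    intro e w hw
    have := hple e
    simp only [hz₀, hmInf] at hw
    linarith
  -- the middle set and its thickening radius
  have hMsub : hub.MsetH t ⊆ Ω := hub.MsetH_subset ht0 ht
  obtain ⟨r₁, hr₁, hr₁sub⟩ := (hub.isCompact_MsetH t).exists_cthickening_subset_open hub.isOpen hMsub
  set rM : ℝ := min r₁ hub.rh with hrMdef
  have hrMpos : 0 < rM := lt_min hr₁ hrh
  have hMball := hub.MsetH_subset_ball ht0.le ht
  have hthick : cthickening rM (hub.MsetH t) ⊆ Ω ∩ ball hub.e (2 * hub.ρB) := by
    intro x hx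
    refine ⟨hr₁sub (cthickening_mono (min_le_left _ _) _ hx), ?_⟩
    have hx' : x ∈ thickening (2 * hub.rh) (hub.MsetH t) :=
      cthickening_subset_thickening' (by linarith) (by linarith) _ (cthickening_mono (min_le_right _ _) _ hx)
    obtain ⟨z, hz, hxz⟩ := mem_thickening_iff.1 hx'
    have := hMball hz
    rw [mem_ball] at this ⊢
    linarith [dist_triangle x z hub.e]
  -- the flat-piece endpoints and the middle paths in the structure's spelling
  set q₁' : ℂ := hub.pmid - ((16 * hub.ell / 2 : ℝ) : ℂ) * dirVec (hub.km + 1) with hq₁'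
  set q₂' : ℂ := hub.pmid + ((16 * hub.ell / 2 : ℝ) : ℂ) * dirVec (hub.km + 1) with hq₂'
  have e_q1 : q₁' = hub.q (-1) := by rw [hq₁', HubData.q, HubData.τ]; push_cast; ring
  have e_q2 : q₂' = hub.q 1 := by rw [hq₂', HubData.q, HubData.τ]; push_cast; ring
  have e_z0 : z₀ 0 = hub.z0 (-1) t := by simp [hz₀, sg]
  have e_z1 : z₀ 1 = hub.z0 1 t := by simp [hz₀, sg]
  set M₁ : Path (z₀ 0) q₁' := (hub.Mpath (-1) t).cast e_z0 e_q1 with hM₁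
  set M₂ : Path q₂' (z₀ 1) := (hub.Mpath 1 t).symm.cast e_q2 e_z1 with hM₂
  have hrM₁ : range M₁ = range (hub.Mpath (-1) t) := by rw [hM₁, Path.cast_coe]
  have hrM₂ : range M₂ = range (hub.Mpath 1 t) := by rw [hM₂, Path.cast_coe, Path.symm_range]
  have hMset : range M₁ ∪ segment ℝ q₁' q₂' ∪ range M₂ = hub.MsetH t := by
    rw [hrM₁, hrM₂, e_q1, e_q2]; rfl
  have hMset' : ∀ x, (x ∈ range M₁ ∨ x ∈ range M₂ ∨ x ∈ segment ℝ q₁' q₂') → x ∈ hub.MsetH t := by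
    intro x hx
    rw [← hMset]
    rcases hx with h | h | h
    · exact Or.inl (Or.inl h)
    · exact Or.inr h
    · exact Or.inl (Or.inr h)
  have hnotM : ∀ x, x ∉ hub.MsetH t → x ∉ range M₁ ∧ x ∉ range M₂ ∧ x ∉ segment ℝ q₁' q₂' :=
    fun x hx => ⟨fun h => hx (hMset' x (Or.inl h)), fun h => hx (hMset' x (Or.inr (Or.inl h))), fun h => hx (hMset' x (Or.inr (Or.inr h)))⟩
  -- the transport path into `W` and the clearance
  set Pw : Path (hub.pmid - ((hub.ell : ℝ) : ℂ) * dirVec hub.km) wW := (Path.segment _ hub.m).trans γW.symm with hPw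
  set K : Set ℂ := range S.Pz ∪ range Pw ∪ closure W with hK
  have hKfacts : ∀ x ∈ K, x ∈ Ω ∧ x ∉ hub.MsetH t ∧ ∀ e, hub.rh / 10 < l1norm (x - hub.z0 (sg e) t) := by
    have haxis : ∀ s, 0 ≤ s → s ≤ hub.rh - hub.ell → hub.ax s ∈ Ω ∧ hub.ax s ∉ hub.MsetH t ∧ ∀ e, hub.rh / 10 < l1norm (hub.ax s - hub.z0 (sg e) t) := by
      intro s hs0 hs1
      refine ⟨hub.closedBall_subset ?_, hub.ax_not_mem_MsetH ht (Or.inl (by linarith)), fun e => ?_⟩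
      · rw [mem_closedBall, HubData.ax, dist_eq_norm, add_sub_cancel_left, norm_mul, Complex.norm_real, Real.norm_eq_abs, hub.norm_ν_τ.1,
          mul_one, abs_of_nonneg hs0]; linarith
      · by_contra h; push Not at h
        have h4 := hub.frame_zone (sg_cases e) ht h
        have hT0 : hub.T (hub.ax s) = 0 := (hub.NT_axis s).2
        rw [hT0, mul_zero] at h4
        linarith
    have hfar : ∀ x, hub.ρB < dist x hub.e → x ∉ hub.MsetH t ∧ ∀ e, hub.rh / 10 < l1norm (x - hub.z0 (sg e) t) := by
      intro x hx
      refine ⟨fun h => ?_, fun e => ?_⟩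
      · have := hMball h; rw [mem_ball] at this; linarith
      · by_contra h; push Not at h
        have := hub.zone_subset_ball (sg_cases e) ht0.le ht ((norm_le_l1norm _).trans (h.trans (by linarith)))
        rw [mem_ball] at this; linarith
    rintro x ((hx | hx) | hx)
    · obtain ⟨h1, h2, -, -⟩ := S.Pz_spec ht hx
      exact ⟨h2, h1, fun e => S.Pz_far_from_zone (sg_cases e) ht hx⟩
    · rw [hPw, Path.trans_range, Path.range_segment] at hx
      rcases hx with hx | ⟨s', rfl⟩
      · obtain ⟨s, hs0, hs1, rfl⟩ := hub.exists_of_mem_segment_yMinus_m hx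
        exact haxis s hs0 hs1
      · show γW (unitInterval.symm s') ∈ Ω ∧ γW (unitInterval.symm s') ∉ hub.MsetH t ∧ ∀ e, hub.rh / 10 < l1norm (γW (unitInterval.symm s') - hub.z0 (sg e) t)
        obtain ⟨hΩ', h | h⟩ := hγW (unitInterval.symm s')
        · exact ⟨hΩ', hfar _ h⟩
        · rw [h, hub.ax_eq.2.2.2]
          exact haxis 0 le_rfl (by linarith)
    · exact ⟨hWΩ hx, hfar _ (hWout x hx)⟩
  have hKc : IsCompact K := ((isCompact_range S.Pz.continuous).union (isCompact_range Pw.continuous)).union hWb.isCompact_closure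
  obtain ⟨d₀, hd₀, hd₀sub⟩ := hKc.exists_cthickening_subset_open hub.isOpen fun x hx => (hKfacts x hx).1
  -- `G` contains `ball e (2 ρ_B)` and the hub ball
  have hG2 : ball hub.e (2 * hub.ρB) ⊆ G := fun x hx => hG (by rw [mem_ball] at hx ⊢; linarith)
  have hGhub : closedBall hub.m (10 * hub.rh) ⊆ G := fun x hx => hG2 (hub.closedBall_subset_ball2 hx)
  have hdist_me : dist hub.m hub.e = hub.ρB := by rw [dist_eq_norm, norm_sub_rev]; exact hme
  -- bounds `mInf e + t ≤ r_h / 17 < r_h / 10`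
  have hmt : ∀ e, mInf e + t < hub.rh / 10 := fun e => by have := hple e; simp only [hmInf]; linarith
  -- the configuration
  let cfg : KCSignConfig Ω G Bad :=
    { z₀ := z₀
      mInf := mInf
      mInf_pos := fun e => hppos e
      diamond_subset := fun e => hpsub e
      touch := fun e => ⟨p e, hpΩ e, rfl⟩
      slack := t
      slack_pos := ht0
      endZone_subset := fun e w hw => by
        have h1 := hzone e w hw
        exact hG2 (ball_subset_ball (by linarith) (hub.zone_subset_ball (sg_cases e) ht0.le ht ((norm_le_l1norm _).trans (h1.trans (by linarith)))))
      endZone_disjoint := fun w hw => by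
        by_contra h; push Not at h
        have h0 : l1norm (w - hub.z0 (sg 0) t) ≤ hub.rh / 10 := by have := hmt 0; exact hw.trans (by linarith)
        have h1 : l1norm (w - hub.z0 (sg 1) t) ≤ hub.rh / 10 := by have := hmt 1; exact h.trans (by linarith)
        have f0 := hub.frame_zone (sg_cases 0) ht h0
        have f1 := hub.frame_zone (sg_cases 1) ht h1
        have hs0 : sg 0 = -1 := if_pos rfl
        have hs1 : sg 1 = 1 := if_neg (by decide)
        rw [hs0] at f0; rw [hs1] at f1
        linarith
      km := hub.km
      pmid := hub.pmid
      len := 16 * hub.ell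
      len_pos := by positivity
      M₁ := M₁
      M₂ := M₂
      rM := rM
      rM_pos := hrMpos
      mid_thick_subset := by
        show cthickening rM (range M₁ ∪ segment ℝ q₁' q₂' ∪ range M₂) ⊆ Ω ∩ G
        rw [hMset]; exact fun x hx => ⟨(hthick hx).1, hG2 (hthick hx).2⟩
      ℓ := hub.ell
      ℓ_pos := hℓ
      ℓ_le := by linarith
      clearBox_subset := fun w hw => by
        obtain ⟨h1, h2⟩ := hw
        have hn : ‖w - hub.m‖ ≤ 10 * hub.rh := by
          have k1 := hub.norm_sub_le_NT w hub.pmid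
          have k2 : hub.N hub.pmid = 0 ∧ hub.T hub.pmid = 0 := by
            obtain ⟨a1, a2⟩ := hub.NT_axis hub.rh
            rw [show hub.m + ((hub.rh : ℝ) : ℂ) * hub.ν = hub.pmid from rfl] at a1 a2
            exact ⟨by rw [a1]; ring, a2⟩
          rw [k2.1, k2.2, sub_zero, sub_zero] at k1
          have k3 : ‖hub.pmid - hub.m‖ = hub.rh := by
            rw [HubData.pmid, add_sub_cancel_left, norm_mul, Complex.norm_real, Real.norm_eq_abs, hub.norm_ν_τ.1, mul_one, abs_of_pos hrh]
          have k4 : ‖w - hub.m‖ ≤ ‖w - hub.pmid‖ + ‖hub.pmid - hub.m‖ := by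
            calc ‖w - hub.m‖ = ‖(w - hub.pmid) + (hub.pmid - hub.m)‖ := by congr 1; ring
              _ ≤ _ := norm_add_le _ _
          have : |hub.N w| ≤ 2 * hub.ell := h1
          have : |hub.T w| ≤ 2 * hub.ell := h2
          linarith
        have hmem : w ∈ closedBall hub.m (10 * hub.rh) := by rw [mem_closedBall, dist_eq_norm]; exact hn
        exact ⟨hub.closedBall_subset hmem, hGhub hmem⟩
      clearBox_mid := fun w _ h2 => by
        constructor
        · intro hw
          rw [hrM₁] at hw
          have := hub.abs_T_ge_of_mem_Mpath (Or.inr rfl) ht hw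
          have h2' : |hub.T w| ≤ 2 * hub.ell := h2
          linarith
        · intro hw
          rw [hrM₂] at hw
          have := hub.abs_T_ge_of_mem_Mpath (Or.inl rfl) ht hw
          have h2' : |hub.T w| ≤ 2 * hub.ell := h2
          linarith
      clearBox_end := fun w _ h2 e => by
        by_contra h; push Not at h
        have h4 := hub.frame_zone (sg_cases e) ht (h.trans (hmt e).le)
        have h2' : |hub.T w| ≤ 2 * hub.ell := h2
        rw [abs_le] at h2'
        rcases sg_cases e with h' | h' <;> rw [h'] at h4 <;> linarith
      zStar := S.zStar
      κ := κ
      κ_pos := hκpos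
      κ_le := hκℓ
      seed_near := by
        obtain ⟨q, hq, hqd⟩ := S.exists_seed_frontier
        refine ⟨q, hq, hqd, hG ?_⟩
        rw [mem_ball]
        have := hub.dist_zStar_le S
        linarith [dist_triangle q S.zStar hub.e]
      seedBall_subset := fun w hw => by
        apply hG
        rw [mem_closedBall] at hw
        rw [mem_ball]
        have := hub.dist_zStar_le S
        linarith [dist_triangle w S.zStar hub.e]
      seedBall_mid := fun w hw => hnotM w (S.seedBall_not_mem_MsetH ht hw)
      dR := hub.rh
      dR_pos := hrh
      far_end_seed := fun e w hw => S.far_end_seed (sg_cases e) ht (hw.trans (hmt e).le)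
      J := S.Jc
      w := S.wc
      w_zero := S.wc_zero
      w_step := fun j _ => S.wc_step j
      window_subset := fun j hj x hx => ⟨S.window_subset hj hx, hG (hub.window_subset_ball3 S hj hx)⟩
      window_mid := fun j hj x hx => hnotM x (S.window_not_mem_MsetH hj ht hx)
      window_end := fun j hj x hx e => lt_of_le_of_lt (hmt e).le (S.window_far_from_zone hj (sg_cases e) ht hx)
      farside := fun t' ht' => S.farside t' ht'
      Pz := S.Pz
      W := W
      W_open := hWo
      W_conn := hWc
      W_bdd := hWb
      Bad_subset := hBad
      wW := wW
      wW_mem := hwW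
      Pw := Pw
      d₀ := d₀
      d₀_pos := hd₀
      paths_thick_subset := hd₀sub
      paths_mid := fun x hx => hnotM x (hKfacts x hx).2.1
      paths_end := fun x hx e => lt_of_le_of_lt (hmt e).le ((hKfacts x hx).2.2 e) }
  refine ⟨cfg, rfl, fun μ hμ => ?_, ?_⟩
  · show (⋃ e : Fin 2, {w | l1norm (w - z₀ e) ≤ mInf e - μ / 2}) ∪ cthickening rM (range M₁ ∪ segment ℝ q₁' q₂' ∪ range M₂) ⊆ Ω ∩ ball hub.e (2 * hub.ρB)
    rw [hMset]
    rintro x (hx | hx)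
    · simp only [Set.mem_iUnion, Set.mem_setOf_eq] at hx
      obtain ⟨e, he⟩ := hx
      refine ⟨hpsub e (by show l1norm (x - hub.z0 (sg e) t) < l1norm (p e - hub.z0 (sg e) t); simp only [hz₀, hmInf] at he; linarith), ?_⟩
      have h1 : l1norm (x - hub.z0 (sg e) t) ≤ hub.rh / 10 := hzone e x (by linarith [ht0])
      exact ball_subset_ball (by linarith) (hub.zone_subset_ball (sg_cases e) ht0.le ht ((norm_le_l1norm _).trans (h1.trans (by linarith))))
    · exact hthick hx
  · show cthickening rM (segment ℝ q₁' q₂') ⊆ Ω ∩ ball hub.e (2 * hub.ρB)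
    intro x hx
    refine hthick (cthickening_subset_of_subset _ ?_ hx)
    rw [← hMset]; intro y hy; exact Or.inl (Or.inr hy)

end HubData

/-! ### The configuration near a boundary point -/

/-- **Existence of the sign-condition configuration near a boundary point.** Let `Ω` be open and
path-connected, `ζ ∈ ∂Ω`, `ρ > 0`, with an exterior point (a point off `closure Ω`) within
`ρ/10` of `ζ` (automatic for Jordan domains); let `G ⊇ ball ζ ρ`, and let `W` be an open,
path-connected, bounded exceptional region with `Bad ⊆ W`, `closure W ⊆ Ω` and
`closure W ∩ ball ζ ρ = ∅`. Then there is a `KCSignConfig Ω G Bad` whose compact sets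
`Kmid μ` (`μ > 0`) and `Kflat` lie in `Ω ∩ ball ζ ρ`. [folklore] -/
theorem exists_config {Ω G Bad W : Set ℂ} (hΩ : IsOpen Ω) (hΩc : IsPathConnected Ω) {ζ : ℂ} (hζ : ζ ∈ frontier Ω) {ρ : ℝ}
    (hext : ∃ e, dist e ζ < ρ / 10 ∧ e ∉ closure Ω) (hG : ball ζ ρ ⊆ G)
    (hWo : IsOpen W) (hWc : IsPathConnected W) (hWb : Bornology.IsBounded W) (hBad : Bad ⊆ W) (hWΩ : closure W ⊆ Ω)
    (hWfar : ∀ x ∈ closure W, ρ ≤ dist x ζ) (hWne : W.Nonempty) :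
    ∃ cfg : KCSignConfig Ω G Bad, cfg.W = W ∧ (∀ μ, 0 < μ → cfg.Kmid μ ⊆ Ω ∩ ball ζ ρ) ∧ cfg.Kflat ⊆ Ω ∩ ball ζ ρ := by
  obtain ⟨e, he, heΩ⟩ := hext
  obtain ⟨wW, hwW⟩ := hWne
  have hwWΩ : wW ∈ Ω := hWΩ (subset_closure hwW)
  obtain ⟨hub, hube, hubρ, γW, hγW⟩ := exists_hubData hΩ hΩc hζ he heΩ hwWΩ (hWfar wW (subset_closure hwW))
  have hρB := hub.ρB_spec.1
  have hball : ball hub.e (3 * hub.ρB) ⊆ ball ζ ρ := fun x hx => by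
    rw [mem_ball] at hx ⊢
    rw [hube] at hx
    linarith [dist_triangle x e ζ]
  have hWout : ∀ x ∈ closure W, hub.ρB < dist x hub.e := fun x hx => by
    have := hWfar x hx
    rw [hube]
    linarith [dist_triangle x e ζ]
  have hγW' : ∀ s, γW s ∈ Ω ∧ (hub.ρB < dist (γW s) hub.e ∨ γW s = hub.m) := by rw [hube]; exact hγW
  obtain ⟨cfg, hW, h1, h2⟩ := hub.exists_config_core (hball.trans hG) hWo hWc hWb hBad hWΩ hWout hwW γW hγW'
  have hsub : Ω ∩ ball hub.e (2 * hub.ρB) ⊆ Ω ∩ ball ζ ρ := fun x hx => ⟨hx.1, hball (ball_subset_ball (by linarith) hx.2)⟩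
  exact ⟨cfg, hW, fun μ hμ => (h1 μ hμ).trans hsub, h2.trans hsub⟩

end Literature.Probability.LatticeModels
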